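import Literature.Geometry.Lorentzian.CoordConjugateHeat
import Literature.Geometry.Lorentzian.CoordEnergyEvolution
import HarnessLib

/-!
# Joint smoothness on `V × S` of `|∇f|²`, `Hess f`, `Δf`, `∂_t f` and of Perelman's `v` along a metric family

Regularity companion of `CoordConjugateHeat.lean`. For a smooth one-parameter family of metric
components `G` on `V × S` (`IsMetricFamilyOn G S V`) and time-dependent scalar functions `f`,
`u`, `C^∞` on `V × S`, the coordinate objects built from them are `C^∞` jointly in `(y, t)` on
`V × S`:

* `contDiffOn_mtrAt_family`, `contDiffOn_scalAt_family` — metric traces and the scalar curvature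
  along the family (`♯` and `Ric` are jointly smooth: `contDiffOn_sharpAt_family`,
  `contDiffOn_ricAt_family`);
* `contDiffOn_gradSqAt_family`, `contDiffOn_hessAt_family`, `contDiffOn_lapAt_family`;
* `contDiffOn_tDerivFun_family` — the time derivative within `S` of a jointly smooth scalar
  function is jointly smooth (it is a component of the derivative within `V × S`);
* `contDiffOn_entropyIntegrand_family`, `contDiffOn_conjHeatEntropyDensity_family` — Perelman's
  `P = τ(2Δf − |∇f|² + R) + f − n` and `v = P u` (Topping 2006, (8.2.3)) for a positive
  conjugate heat solution `u`.

This is the standing convention "everything is smooth on space-time" of Topping 2006, §1.2.3,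
read in a chart; it feeds the joint continuity of `v` and `∂_t v` used to differentiate
`∫ v dV` in Remark 8.2.7. Everything is proved; no definition is introduced.

## References

* P. Topping, *Lectures on the Ricci flow*, LMS Lecture Note Series 325, CUP 2006, §1.2.3,
  (8.2.3), Remark 8.2.7. [Topping2006]
-/

noncomputable section

set_option maxSynthPendingDepth 3

open Set Filter ContinuousLinearMap Module
open scoped Topology ContDiff

namespace Literature.Geometry.Lorentzian

namespace MetricCoord

variable {E : Type*} [NormedAddCommGroup E] [NormedSpace ℝ E] [FiniteDimensional ℝ E]
  [CompleteSpace E]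

namespace IsMetricFamilyOn

variable {G : ℝ → E → E →L[ℝ] E →L[ℝ] ℝ} {S : Set ℝ} {V : Set E} {f u : ℝ → E → ℝ} {c : ℝ}

/-- **Metric traces along the family are jointly smooth**: for a field of bilinear forms
`β : E × ℝ → (E →L E →L ℝ)`, `C^∞` on `V × S`, `(y, t) ↦ tr_{G t}(β(y,t))` is `C^∞` on `V × S`.
[cite: Topping2006, §1.2.3] -/
theorem contDiffOn_mtrAt_family (hG : IsMetricFamilyOn G S V) {β : E × ℝ → E →L[ℝ] E →L[ℝ] ℝ}
    (hβ : ContDiffOn ℝ ∞ β (V ×ˢ S)) :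
    ContDiffOn ℝ ∞ (fun q : E × ℝ ↦ mtrAt (G q.2) q.1 (β q)) (V ×ˢ S) := by
  simp only [mtrAt_eq_traceCLM]
  exact (traceCLM E).contDiff.comp_contDiffOn (hG.contDiffOn_sharpAt_family.clm_comp hβ)

/-- **The scalar curvature along the family is jointly smooth**: `(y, t) ↦ S(G t)(y)` is `C^∞`
on `V × S`. [cite: Topping2006, §1.2.3] -/
theorem contDiffOn_scalAt_family (hG : IsMetricFamilyOn G S V) :
    ContDiffOn ℝ ∞ (fun q : E × ℝ ↦ scalAt (G q.2) q.1) (V ×ˢ S) :=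
  hG.contDiffOn_mtrAt_family hG.contDiffOn_ricAt_family

omit [FiniteDimensional ℝ E] [CompleteSpace E] in
/-- The second differential of the slices of a jointly smooth scalar function is jointly smooth.
[folklore] -/
theorem contDiffOn_fderiv_fderiv_of_family (hG : IsMetricFamilyOn G S V)
    (hf : ContDiffOn ℝ ∞ (fun p : E × ℝ ↦ f p.2 p.1) (V ×ˢ S)) :
    ContDiffOn ℝ ∞ (fun p : E × ℝ ↦ fderiv ℝ (fderiv ℝ (f p.2)) p.1) (V ×ˢ S) := by
  by_cases hS : S = ∅
  · simp [hS]
  obtain ⟨t₀, ht₀⟩ := Set.nonempty_iff_ne_empty.mpr hS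
  have hV := hG.isOpen ht₀
  exact contDiffOn_fderiv_slice (F := fun p : E × ℝ ↦ fderiv ℝ (f p.2) p.1) hV hG.uniqueDiffOn
    (contDiffOn_fderiv_of_family hV hG.uniqueDiffOn hf)

omit [FiniteDimensional ℝ E] in
/-- **`(y, t) ↦ |∇f_t|²_{G t}(y)` is jointly smooth.** [cite: Topping2006, §1.2.3] -/
theorem contDiffOn_gradSqAt_family (hG : IsMetricFamilyOn G S V)
    (hf : ContDiffOn ℝ ∞ (fun p : E × ℝ ↦ f p.2 p.1) (V ×ˢ S)) :
    ContDiffOn ℝ ∞ (fun q : E × ℝ ↦ gradSqAt (G q.2) (f q.2) q.1) (V ×ˢ S) := by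
  by_cases hS : S = ∅
  · simp [hS]
  obtain ⟨t₀, ht₀⟩ := Set.nonempty_iff_ne_empty.mpr hS
  have hV := hG.isOpen ht₀
  have hD := contDiffOn_fderiv_of_family hV hG.uniqueDiffOn hf
  simp only [gradSqAt_apply]
  exact hD.clm_apply (hG.contDiffOn_sharpAt_family.clm_apply hD)

omit [FiniteDimensional ℝ E] in
/-- **`(y, t) ↦ Hess_{G t} f_t (y)` is jointly smooth.** [cite: Topping2006, §1.2.3] -/
theorem contDiffOn_hessAt_family (hG : IsMetricFamilyOn G S V)
    (hf : ContDiffOn ℝ ∞ (fun p : E × ℝ ↦ f p.2 p.1) (V ×ˢ S)) :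
    ContDiffOn ℝ ∞ (fun q : E × ℝ ↦ hessAt (G q.2) (f q.2) q.1) (V ×ˢ S) := by
  by_cases hS : S = ∅
  · simp [hS]
  obtain ⟨t₀, ht₀⟩ := Set.nonempty_iff_ne_empty.mpr hS
  have hV := hG.isOpen ht₀
  have hD := contDiffOn_fderiv_of_family hV hG.uniqueDiffOn hf
  have hD2 := hG.contDiffOn_fderiv_fderiv_of_family hf
  have hA : ContDiffOn ℝ ∞ (fun q : E × ℝ ↦ ContinuousLinearMap.compL ℝ E E ℝ (fderiv ℝ (f q.2) q.1))
      (V ×ˢ S) := (ContinuousLinearMap.compL ℝ E E ℝ).contDiff.comp_contDiffOn hD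
  have heq : (fun q : E × ℝ ↦ hessAt (G q.2) (f q.2) q.1) = fun q ↦
      fderiv ℝ (fderiv ℝ (f q.2)) q.1 -
        (ContinuousLinearMap.compL ℝ E E ℝ (fderiv ℝ (f q.2) q.1)).comp (chrAt (G q.2) q.1) := by
    funext q; rfl
  rw [heq]
  exact hD2.sub (hA.clm_comp hG.contDiffOn_chrAt_family)

/-- **`(y, t) ↦ Δ_{G t} f_t (y)` is jointly smooth.** [cite: Topping2006, §1.2.3] -/
theorem contDiffOn_lapAt_family (hG : IsMetricFamilyOn G S V)
    (hf : ContDiffOn ℝ ∞ (fun p : E × ℝ ↦ f p.2 p.1) (V ×ˢ S)) :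
    ContDiffOn ℝ ∞ (fun q : E × ℝ ↦ lapAt (G q.2) (f q.2) q.1) (V ×ˢ S) :=
  hG.contDiffOn_mtrAt_family (hG.contDiffOn_hessAt_family hf)

omit [FiniteDimensional ℝ E] [CompleteSpace E] in
/-- **The time derivative within `S` of a jointly smooth scalar function is jointly smooth**:
for `V` open and `S` with unique derivatives, `(y, t) ↦ ḟ_t(y)` is `C^∞` on `V × S` (it is the
component `DF(y,t)(0,1)` of the derivative of `F(y,t) = f_t(y)` within `V × S`). [folklore] -/
theorem _root_.Literature.Geometry.Lorentzian.MetricCoord.contDiffOn_tDerivFun_prod (hV : IsOpen V)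
    (hS : UniqueDiffOn ℝ S) (hf : ContDiffOn ℝ ∞ (fun p : E × ℝ ↦ f p.2 p.1) (V ×ˢ S)) :
    ContDiffOn ℝ ∞ (fun q : E × ℝ ↦ tDerivFun f S q.2 q.1) (V ×ˢ S) := by
  have hQ : UniqueDiffOn ℝ (V ×ˢ S) := UniqueDiffOn.prod hV.uniqueDiffOn hS
  have hD : ContDiffOn ℝ ∞ (fun q : E × ℝ ↦ fderivWithin ℝ (fun p : E × ℝ ↦ f p.2 p.1) (V ×ˢ S) q
      ((0 : E), (1 : ℝ))) (V ×ˢ S) := (hf.fderivWithin hQ (by simp)).clm_apply contDiffOn_const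
  refine hD.congr fun q hq ↦ ?_
  exact (hasDerivWithinAt_tslice (F := fun p : E × ℝ ↦ f p.2 p.1) (hf.differentiableOn (by simp))
    hq.1 hq.2).derivWithin (hS q.2 hq.2)

omit [FiniteDimensional ℝ E] [CompleteSpace E] in
/-- The time derivative within `S` of a jointly smooth scalar function is jointly smooth on
`V × S`, for the data `V`, `S` of a metric family. [folklore] -/
theorem contDiffOn_tDerivFun_family (hG : IsMetricFamilyOn G S V)
    (hf : ContDiffOn ℝ ∞ (fun p : E × ℝ ↦ f p.2 p.1) (V ×ˢ S)) :
    ContDiffOn ℝ ∞ (fun q : E × ℝ ↦ tDerivFun f S q.2 q.1) (V ×ˢ S) := by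
  by_cases hS : S = ∅
  · simp [hS]
  obtain ⟨t₀, ht₀⟩ := Set.nonempty_iff_ne_empty.mpr hS
  exact contDiffOn_tDerivFun_prod (hG.isOpen ht₀) hG.uniqueDiffOn hf

/-- **Perelman's `P = τ(2Δf − |∇f|² + R) + f − n` is jointly smooth** for `f` jointly smooth and
`τ` smooth on `S`. [cite: Topping2006, (8.2.3)] -/
theorem contDiffOn_entropyIntegrand_family (hG : IsMetricFamilyOn G S V)
    (hf : ContDiffOn ℝ ∞ (fun p : E × ℝ ↦ f p.2 p.1) (V ×ˢ S)) {τ : ℝ → ℝ} (hτ : ContDiffOn ℝ ∞ τ S) :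
    ContDiffOn ℝ ∞ (fun q : E × ℝ ↦ entropyIntegrand G f τ q.2 q.1) (V ×ˢ S) := by
  have hτ' : ContDiffOn ℝ ∞ (fun q : E × ℝ ↦ τ q.2) (V ×ˢ S) := hτ.comp contDiffOn_snd fun q hq ↦ hq.2
  simp only [entropyIntegrand_apply]
  exact ((hτ'.mul (((contDiffOn_const.mul (hG.contDiffOn_lapAt_family hf)).sub
    (hG.contDiffOn_gradSqAt_family hf)).add hG.contDiffOn_scalAt_family)).add hf).sub contDiffOn_const

/-- **Perelman's `v = P u` is jointly smooth** for a positive `u`, `C^∞` on `V × S`, and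
`τ(s) = c − s > 0` on `S`. [cite: Topping2006, (8.2.3)] -/
theorem contDiffOn_conjHeatEntropyDensity_family (hG : IsMetricFamilyOn G S V)
    (hu : ContDiffOn ℝ ∞ (fun p : E × ℝ ↦ u p.2 p.1) (V ×ˢ S))
    (hpos : ∀ s ∈ S, ∀ y ∈ V, 0 < u s y) (hc : ∀ s ∈ S, s < c) :
    ContDiffOn ℝ ∞ (fun q : E × ℝ ↦ conjHeatEntropyDensity G u c q.2 q.1) (V ×ˢ S) := by
  have hf := contDiffOn_conjHeatPotential hu hpos hc
  have hτ : ContDiffOn ℝ ∞ (fun s : ℝ ↦ c - s) S := (contDiff_const.sub contDiff_id).contDiffOn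
  simp only [conjHeatEntropyDensity_apply]
  exact (hG.contDiffOn_entropyIntegrand_family hf hτ).mul hu

/-- The time derivative of `v` is jointly smooth (hence jointly continuous) on `V × S`.
[cite: Topping2006, Remark 8.2.7] -/
theorem contDiffOn_tDerivFun_conjHeatEntropyDensity_family (hG : IsMetricFamilyOn G S V)
    (hu : ContDiffOn ℝ ∞ (fun p : E × ℝ ↦ u p.2 p.1) (V ×ˢ S))
    (hpos : ∀ s ∈ S, ∀ y ∈ V, 0 < u s y) (hc : ∀ s ∈ S, s < c) :
    ContDiffOn ℝ ∞ (fun q : E × ℝ ↦ tDerivFun (conjHeatEntropyDensity G u c) S q.2 q.1) (V ×ˢ S) :=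
  hG.contDiffOn_tDerivFun_family (hG.contDiffOn_conjHeatEntropyDensity_family hu hpos hc)

end IsMetricFamilyOn

end MetricCoord

end Literature.Geometry.Lorentzian

end
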